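import Summits.SmoothPoincare4.SmoothPoincare4.Theses.SymplecticOrigami
import Summits.SmoothPoincare4.SmoothPoincare4.Theorems.OrigamiRung.Negative.RefutationCost
import Summits.SmoothPoincare4.SmoothPoincare4.Theorems.OrigamiRung.Negative.GenusTable
import Summits.SmoothPoincare4.SmoothPoincare4.Theorems.OrigamiRung.Negative.MeridianPinch
import Summits.SmoothPoincare4.SmoothPoincare4.Theorems.SymplecticOrigamiOrigamiRungStubSides
import Summits.SmoothPoincare4.SmoothPoincare4.Theorems.SymplecticOrigamiOrigamiRungStubSphereOfGenusZero
import Summits.SmoothPoincare4.SmoothPoincare4.Theorems.SymplecticOrigamiOrigamiRungStubBallFunction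
import Summits.SmoothPoincare4.SmoothPoincare4.Theorems.SymplecticOrigamiOrigamiRungStubBallOfSublevel
import Summits.SmoothPoincare4.SmoothPoincare4.Theorems.SymplecticOrigamiOrigamiRungStubGenusFormula
import Summits.SmoothPoincare4.SmoothPoincare4.Theorems.SymplecticOrigamiOrigamiRungStubPinchPieceHomeomorph
import Summits.SmoothPoincare4.SmoothPoincare4.Theorems.SymplecticOrigamiOrigamiRungStubPinchFoldSubmersion
import Summits.SmoothPoincare4.SmoothPoincare4.Theorems.SymplecticOrigamiOrigamiRungStubPinchBlowdownQuotient
import Literature.Topology.FourManifolds.SchoenfliesTools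
import Literature.Topology.FourManifolds.AkbulutKirbyCerfReduction
import Literature.Topology.FourManifolds.HomotopyS4CompactProofs
import Literature.Topology.FourManifolds.InvertedGermExtension
import Literature.Topology.FourManifolds.Morse
import Literature.AlgebraicTopology.SingularHomology.Orientation
import Literature.AlgebraicTopology.SingularHomology.PoincareDuality
import Literature.AlgebraicTopology.SingularHomology.DisjointCarriersCupPairing
import Literature.AlgebraicTopology.SingularHomology.ModPBettiNumbers
import Literature.AlgebraicTopology.SingularHomology.RationalEulerCharacteristic
import Literature.Geometry.Symplectic.CanonicalClassSqAndAdjunctionOfSymplecticFour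
import Literature.Geometry.Symplectic.ThomGysinComplementSurfaceFour
import Literature.Geometry.Symplectic.EulerCharacteristicAddSignatureOfSymplecticFour
import Summits.SmoothPoincare4.SmoothPoincare4.Theorems.SymplecticOrigamiOrigamiRungStubPinchAlexander

/-!
# Line `pair-rigidity-endgame` — skeleton for crux `SymplecticOrigami.OrigamiRung`

**Lead reshape r3 (prover-line-stmt-SmoothPoincare4-7843-c1-0, continuation lead, 2026-08-16).**
State of the line when this seat took over: of the six stubs registered by the first lead
(skeleton `f8440bb42238…`) FIVE are landed under `Theorems/` and are now IMPORTED here by name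
(`stub_sides` p?, `stub_sphereOfGenusZero` p79913, `stub_ballFunction` p90274 (+ calculus /
chart / local helpers), `stub_ballOfSublevel` p81692, and `stub_genusFormula` in the conditional
form `stub_genusFormula_of_canonicalClass_of_thomGysin` p91029 over the two relocated Literature
facts `canonicalClass_sq_and_adjunction_of_symplectic_four` / `thomGysin_complement_surface_four`);
three sub-lemmas of the remaining stub `stub_pinch` are landed as well
(`stub_pinch_pieceHomeomorph` p91836, `stub_pinch_foldSubmersion` p92005,
`stub_pinch_blowdownQuotient` p92562).  Only `stub_pinch` (the SW-free integral pinch; XL as ONE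
statement) is open.

**Reshape r3 = a bundle-free, field-coefficient decomposition of `stub_pinch`** into five
registered stubs, each a self-contained statement over the tree's PROVED singular-homology
library (Mayer–Vietoris `MayerVietorisExactness`, Čech–Poincaré duality along compact sets
`CechDualityCompact`, Čech-to-singular comparison `CechTautness.RetractionNhds`, universal
coefficients over fields `UniversalCoefficientsField`, mod-`p` Betti numbers `ModPBettiNumbers`,
the regular-level collar `RegularLevelCollar`):

* `stub_pinch_sepFun` (geometric): the fold `Z` is the regular zero set of a smooth `τ : M → ℝ`
  with `V 0 = {τ < 0}`, `V 1 = {τ > 0}` (partition of unity over slice charts; the tree's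
  `exists_definingFunction_of_sides` is the Euclidean-ambient model of the proof).
* `stub_pinch_alexander` (M-side): for such a `τ` on a homotopy 4-sphere and every field `F`,
  `h₁(Z; F) = h₁(V 0; F) + h₁(V 1; F)` (the PINCH), `h₁(V 0; F) = h₂(V 1; F)`,
  `h₁(V 1; F) = h₂(V 0; F)`, `h₃(V i; F) = 0` (Alexander duality in the homology sphere `M` along
  the compact sets `closure (V i)` and `Z`: `H̃ₖ(M ∖ K) ≅ H_{k+1}(M, M ∖ K) ≅ Ȟ^{3-k}(K) ≅
  H^{3-k}(↥K)` by Čech duality + collar retractions (tautness) + homotopy invariance + UCT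
  over `F`).
* `stub_pinch_exceptionalNbhd` (interface M ↔ N): the blow-down `β` of a side carries a collar
  band of `Z` onto an OPEN neighbourhood `D ⊇ B` of the exceptional surface with
  `h_k(D; F) = h_k(S; F)` (`D` deformation-retracts onto `B` through the quotient map `β`) and
  `h_k(D ∖ B; F) = h_k(Z; F)` (`D ∖ B ≅ band ∩ V ≃ Z`).
* `stub_pinch_pieceLES` (N-side): for a closed oriented `N ⊃ B = b(S)` (oriented surface) and
  `X = N ∖ B`: finiteness of `H_*(X)` and the two rank relations of the exact sequence of the pair
  `(N, X)` with `H_k(N, X; F) ≅ Ȟ^{4-k}(B; F) ≅ H^{4-k}(S; F)`: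
  `h₁(N) ≤ h₁(X) ≤ h₁(N) + 1` and `h₂(X) + 2h₁(N) + 1 = h₁(S) + h₂(N) + h₁(X) + h₃(X)`.
* `stub_pinch_surfaceNbhdPair` (N-side): for every open `D ⊇ B`, `H₁(D ∖ B; F) → H₁(D; F)` is
  onto with kernel of dimension `≤ 1` (the pair `(D, D ∖ B)`: `H₁(D | B) ≅ Ȟ³(B) = 0`,
  `H₂(D | B) ≅ Ȟ²(B) ≅ F`), and if the rational kernel is non-zero then `b_*[S]` is carried by
  `D ∖ B` (so `B · B = 0` by `cupPairing_eq_zero_of_disjoint_carriers`).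

From these, `hK := canonicalClass_sq_and_adjunction_of_symplectic_four` (only `b⁺ ≥ 1` and
`b_*[S] ∉ torsion`) and the parity fact `hP` (`1 - b₁ + b⁺` even for closed symplectic
4-manifolds, new cite), the pinch follows by RANK BOOKKEEPING over `ℚ` and every `𝔽ₚ`
(`stub_pinch_of_facts`, this seat; no circle bundle, no Euler class, no Thom–Gysin):
with `aᵢ = h₁(Xᵢ)`, `cᵢ = h₂(Xᵢ)`, `r = h₁(Z) = a₀ + a₁`, `a₀ = c₁`, `a₁ = c₀`, the piece
relations give `r = h₁(Sᵢ) + h₂(Nᵢ) + 1 - 2εᵢ` (`εᵢ = h₁(Nᵢ) + 1 - aᵢ ∈ {0,1}`) while the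
neighbourhood pair gives `h₁(Sᵢ) ≤ r ≤ h₁(Sᵢ) + 1`; `h₂(Nᵢ; F) ≥ b⁺ ≥ 1` forces `εᵢ = 1`,
`h₂(Nᵢ; F) ∈ {1, 2}`, equal genera; over `ℚ`, `h₂ = 2` gives `Bᵢ² = 0` (carried by the
complement), an isotropic non-torsion class in a unimodular rank-2 lattice with `b⁺ ≥ 1`, so
`b⁺ = b⁻ = 1`, parity makes both `b₁(Nᵢ)` even, contradicting `r = 2g + 1` odd; so `b₂(Nᵢ) = 1`,
`a₀ + a₁ = 2g`; over `𝔽ₚ`, `h₂(Nᵢ; 𝔽ₚ) = 2` would put `p`-torsion in exactly one `H₁(Xⱼ)`, and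
on the other piece `h₁(N; 𝔽ₚ) = b₁`, hence (Poincaré duality mod `p`) `h₂(N; 𝔽ₚ) = 1` —
contradiction; so every `H₁(Xᵢ; ℤ)` is torsion-free, i.e. `≅ ℤ^{aᵢ}`.

Composition `OrigamiRung_of (hMW) (hC)` unchanged in shape (kernel-checked); the three Literature
facts enter through the declared stub `stub_facts` (to become route items); `sorry` only in the
registered stubs.  Until `stub_pinch_of_facts` is closed the old `stub_pinch` stays registered
(sorried) and is what `OrigamiRung_of` consumes.

(item stmt-SmoothPoincare4-7843, route `route-SmoothPoincare4-SymplecticOrigami`;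
idea card `Cruxes/OrigamiRung/Ideas/pair-rigidity-endgame.md`; triage r1-1/2/3: pass;
Disproof.lean gen 1–4 read: §6a audits all six r2 stubs TRUE AS TYPED, 0 targets; the new stubs
conclude Betti/torsion data of the PIECES or of neighbourhood pairs, none concludes `M ≅ S⁴`, so
none is SPC4-protected (§1/§5b) and each is refutable by typed data.)
-/

noncomputable section

-- the prescribed namespace `Summit.<P>.<Sub>.…` duplicates `SmoothPoincare4` (P = Sub)
set_option linter.dupNamespace false

open scoped Manifold ContDiff Topology ContinuousMap
open Set TopologicalSpace
open Literature.Topology.FourManifolds (singularHomologyZ sphereInversion IsTwistedSphere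
  cerf_twistedSphere_four)
open Literature.Geometry.Kaehler (MForm IsSmoothForm IsClosedForm)
open Literature.AlgebraicTopology.SingularHomology (singularHomology HomologicalOrientation
  singularCohomology poincareDualityMap cupPairing intersectionForm)
open Summit.SmoothPoincare4.SmoothPoincare4.Theorems.OrigamiRung.PairRigidityEndgame
  (stub_sides stub_sphereOfGenusZero stub_ballFunction stub_ballOfSublevel
   stub_genusFormula_of_canonicalClass_of_thomGysin stub_pinch_pieceHomeomorph
   stub_pinch_foldSubmersion stub_pinch_blowdownQuotient stub_pinch_alexander)

namespace Summit.SmoothPoincare4.SmoothPoincare4.Cruxes.OrigamiRung.PairRigidityEndgame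

/-- Model space `ℝⁿ`. -/
local notation "𝔼" n:arg => EuclideanSpace ℝ (Fin n)
/-- The round 4-sphere (target of the crux). -/
local notation "𝕊⁴" => (Metric.sphere (0 : EuclideanSpace ℝ (Fin 5)) 1)
/-- The round 2-sphere. -/
local notation "𝕊²" => (Metric.sphere (0 : EuclideanSpace ℝ (Fin 3)) 1)
/-- The closed unit 4-ball with its manifold-with-boundary structure (`ClosedBall.lean`). -/
local notation "𝔻⁴" => (Metric.closedBall (0 : EuclideanSpace ℝ (Fin (3 + 1))) 1)

/-- The route item `CerfGammaFour` is literally the tree's named fact `cerf_twistedSphere_four`. -/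
theorem cerfGammaFour_iff :
    Summit.SmoothPoincare4.SmoothPoincare4.Theses.SymplecticOrigami.CerfGammaFour ↔
      cerf_twistedSphere_four :=
  Iff.rfl

/-! ## Registered stubs of reshape r3: the decomposition of the pinch -/

/-- **Stub P0 — separating function of the fold (geometric, L).**  On a compact boundaryless
4-manifold `M` let `V 0`, `V 1` be disjoint open sets whose common complement is the image of a
smooth embedding `z` of a 3-manifold and is the frontier of each `V i` (the sides lemma).  Then
there is a smooth `τ : M → ℝ` with `V 0 = {τ < 0}`, `V 1 = {τ > 0}` (so `range z = {τ = 0}`)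
and `dτ ≠ 0` along `{τ = 0}` (a regular level).  Proof plan: at each fold point a slice chart
of `z` (Mathlib's `Manifold.IsImmersionAt` charts, as in the landed `stub_sides` /
`exists_slice_box`) gives a local coordinate `t` vanishing exactly on `Z` with `dt ≠ 0`; its two
open half-balls are connected subsets of `V 0 ⊔ V 1` adherent to the fold point, hence lie in
DIFFERENT pieces (both frontiers are `Z`); sign-normalise `t > 0 ⇔ V 1`; glue the local `t`'s
with the constants `∓1` on `V 0`, `V 1` by a smooth partition of unity
(`SmoothPartitionOfUnity.exists_isSubordinate`); off `Z` every summand has the sign of the side,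
on `Z` all summands vanish and their differentials are positive on any `V 1`-pointing vector,
so `dτ ≠ 0` there.  Euclidean-ambient model of exactly this argument, proved in the tree:
`Literature.Topology.FourManifolds.exists_definingFunction_of_sides`
(`SeifertAlgebraicModelsDefiningFunction.lean`). [folklore] -/
theorem stub_pinch_sepFun :
    ∀ (M : Type) [TopologicalSpace M] [T2Space M] [SecondCountableTopology M] [CompactSpace M]
      [ChartedSpace (𝔼 4) M] [IsManifold (𝓡 4) ∞ M]
      (V : Fin 2 → Opens M) (Z : Type) [TopologicalSpace Z] [ChartedSpace (𝔼 3) Z]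
      [IsManifold (𝓡 3) ∞ Z] (z : Z → M),
      Disjoint (V 0) (V 1) →
      Manifold.IsSmoothEmbedding (𝓡 3) (𝓡 4) ∞ z →
      Set.range z = ((V 0 : Set M) ∪ (V 1 : Set M))ᶜ →
      (∀ i, frontier (V i : Set M) = Set.range z) →
      ∃ τ : M → ℝ, ContMDiff (𝓡 4) 𝓘(ℝ, ℝ) ∞ τ ∧
        (∀ x, τ x = 0 → mfderiv (𝓡 4) 𝓘(ℝ, ℝ) τ x ≠ 0) ∧
        {x | τ x < 0} = (V 0 : Set M) ∧ {x | 0 < τ x} = (V 1 : Set M) := by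
  sorry

/-! **Stub P1 — Alexander duality across the fold (M-side)** is LANDED:
`Summit.SmoothPoincare4.SmoothPoincare4.Theorems.OrigamiRung.PairRigidityEndgame.stub_pinch_alexander`
(p112272, file `Theorems/SymplecticOrigamiOrigamiRungStubPinchAlexander.lean`, imported above). -/


/-- **Stub P3 — the exceptional neighbourhood (interface, L).**  Let `M` be a compact connected
boundaryless 4-manifold, `τ : M → ℝ` smooth with `0` a regular level, `V` one of its two sides,
`b : S → N` a smooth embedding of a compact connected surface into a closed connected 4-manifold
and `β : M → N` the blow-down of the piece `V`: smooth near `closure V`, injective on `V` with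
image `N ∖ B` (`B = range b`) and bijective differential there, `β (frontier V) ⊆ B`.  Then `B`
has an OPEN neighbourhood `D` with, for every field `F` and every `k`,
`h_k(D; F) = h_k(S; F)` and `h_k(D ∖ B; F) = h_k({τ = 0}; F)`.
Construction: `T = τ⁻¹(-δ, δ)` the collar band of the regular level (`RegularLevelCollar.lean`),
`D := β '' (T ∩ closure V)`.  (a) `β|closure V` is a quotient map onto `N` folding
`frontier V = {τ = 0}` onto `B` (landed `stub_pinch_blowdownQuotient`), `T ∩ closure V` is open
in `closure V` and SATURATED (it contains the full fibre `{τ = 0}` over `B`; `β` is injective on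
`V` with `β V ∩ B = ∅`), so `D` is open and `B ⊆ D`.  (b) `D ∖ B = β '' (T ∩ V) ≅ T ∩ V`
(restriction of the homeomorphism `V ≅ N ∖ B`, landed `stub_pinch_pieceHomeomorph`) and
`T ∩ V ≃ {τ = 0}` (flow of the collar), so `h_k(D ∖ B) = h_k({τ = 0})`.  (c) The radial
deformation `(x, s) ↦ U.fl x (-s τ x)` of `T ∩ closure V` onto `{τ = 0}` descends through the
quotient map `β` (it is constant on fibres at every time; `IsQuotientMap.continuous_lift_prod_left`)
to a deformation retraction of `D` onto `B`, so `B ↪ D` is a homotopy equivalence and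
`h_k(D) = h_k(B) = h_k(S)` (`b : S ≅ B`). [folklore] -/
theorem stub_pinch_exceptionalNbhd :
    ∀ (M : Type) [TopologicalSpace M] [T2Space M] [SecondCountableTopology M] [CompactSpace M]
      [ConnectedSpace M] [ChartedSpace (𝔼 4) M] [IsManifold (𝓡 4) ∞ M]
      (N : Type) [TopologicalSpace N] [T2Space N] [SecondCountableTopology N] [CompactSpace N]
      [ConnectedSpace N] [ChartedSpace (𝔼 4) N] [IsManifold (𝓡 4) ∞ N]
      (S : Type) [TopologicalSpace S] [CompactSpace S] [ConnectedSpace S] [ChartedSpace (𝔼 2) S]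
      [IsManifold (𝓡 2) ∞ S]
      (τ : M → ℝ) (V : Set M) (b : S → N) (β : M → N),
      ContMDiff (𝓡 4) 𝓘(ℝ, ℝ) ∞ τ → (∀ x, τ x = 0 → mfderiv (𝓡 4) 𝓘(ℝ, ℝ) τ x ≠ 0) →
      (V = {x : M | τ x < 0} ∨ V = {x : M | 0 < τ x}) →
      Manifold.IsSmoothEmbedding (𝓡 2) (𝓡 4) ∞ b →
      (∃ U : Set M, IsOpen U ∧ closure V ⊆ U ∧ ContMDiffOn (𝓡 4) (𝓡 4) ∞ β U) →
      Set.InjOn β V → β '' V = (Set.range b)ᶜ →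
      (∀ x ∈ V, Function.Bijective (mfderiv (𝓡 4) (𝓡 4) β x)) →
      β '' frontier V ⊆ Set.range b →
      ∃ D : Set N, IsOpen D ∧ Set.range b ⊆ D ∧
        ∀ (F : Type) [Field F] (k : ℕ),
          Module.finrank F (singularHomology F F ↥D k) =
              Module.finrank F (singularHomology F F S k) ∧
            Module.finrank F (singularHomology F F ↥(D \ Set.range b) k) =
              Module.finrank F (singularHomology F F ↥{x : M | τ x = 0} k) := by
  sorry

/-- **Stub P3' — the exceptional neighbourhood, isomorphism form (interface, S given P3's proof).**
Same hypotheses as `stub_pinch_exceptionalNbhd`; the conclusion is upgraded from equalities of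
`finrank`s to linear equivalences `H_k(D; F) ≃ H_k(S; F)` and `H_k(D ∖ B; F) ≃ H_k({τ = 0}; F)`
(which the landed proof of P3 constructs anyway: `D ≃ₕ B ≅ S`, `D ∖ B ≅ band ∩ V ≃ {τ = 0}`), so
that FINITENESS of `H_k(D ∖ B; F)` and `H_k(D; F)` can be transported from the compact `3`-manifold
`{τ = 0}` and the compact surface `S` — needed by the lead's rank–nullity step
`dim H₁(D ∖ B) = dim ker + dim H₁(D)` (a bare `finrank` equality does not exclude the junk value
`finrank = 0` of an infinite-dimensional space). [folklore] -/
theorem stub_pinch_exceptionalNbhdIso :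
    ∀ (M : Type) [TopologicalSpace M] [T2Space M] [SecondCountableTopology M] [CompactSpace M]
      [ConnectedSpace M] [ChartedSpace (𝔼 4) M] [IsManifold (𝓡 4) ∞ M]
      (N : Type) [TopologicalSpace N] [T2Space N] [SecondCountableTopology N] [CompactSpace N]
      [ConnectedSpace N] [ChartedSpace (𝔼 4) N] [IsManifold (𝓡 4) ∞ N]
      (S : Type) [TopologicalSpace S] [CompactSpace S] [ConnectedSpace S] [ChartedSpace (𝔼 2) S]
      [IsManifold (𝓡 2) ∞ S]
      (τ : M → ℝ) (V : Set M) (b : S → N) (β : M → N),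
      ContMDiff (𝓡 4) 𝓘(ℝ, ℝ) ∞ τ → (∀ x, τ x = 0 → mfderiv (𝓡 4) 𝓘(ℝ, ℝ) τ x ≠ 0) →
      (V = {x : M | τ x < 0} ∨ V = {x : M | 0 < τ x}) →
      Manifold.IsSmoothEmbedding (𝓡 2) (𝓡 4) ∞ b →
      (∃ U : Set M, IsOpen U ∧ closure V ⊆ U ∧ ContMDiffOn (𝓡 4) (𝓡 4) ∞ β U) →
      Set.InjOn β V → β '' V = (Set.range b)ᶜ →
      (∀ x ∈ V, Function.Bijective (mfderiv (𝓡 4) (𝓡 4) β x)) →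
      β '' frontier V ⊆ Set.range b →
      ∃ D : Set N, IsOpen D ∧ Set.range b ⊆ D ∧
        ∀ (F : Type) [Field F] (k : ℕ),
          Nonempty (singularHomology F F ↥D k ≃ₗ[F] singularHomology F F S k) ∧
            Nonempty (singularHomology F F ↥(D \ Set.range b) k ≃ₗ[F]
              singularHomology F F ↥{x : M | τ x = 0} k) := by
  sorry

/-- **Stub P4 — the exact sequence of the piece, with field coefficients (N-side, XL).**  Let
`N` be a closed connected `ℤ`-oriented 4-manifold, `S` a compact connected `ℤ`-oriented surface,
`b : S → N` a smooth embedding, `X = N ∖ b(S)` (as the subtype `↥(range b)ᶜ`).  Then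
`H₁(X; ℤ)` is finitely generated, and for every field `F`: all `H_k(X; F)` are
finite-dimensional, `h₁(N) ≤ h₁(X) ≤ h₁(N) + 1`, and
`h₂(X) + 2 h₁(N) + 1 = h₁(S) + h₂(N) + h₁(X) + h₃(X)`.
Proof plan: exact sequence of the pair `(N, X)` (`RelativeHomology.lean`, Mathlib's homology
sequence of `shortExact_subsetι_π`) with `H_k(N, X; F) ≅ Ȟ^{4-k}(B; F)` (Čech duality along
the compact `B = range b`, `CechDuality.classAlong_of_isCompact`, for the `F`-orientation induced
by the `ℤ`-orientation) `≅ H^{4-k}(B; F) ≅ H^{4-k}(S; F)` (`B` is a compact submanifold: a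
neighbourhood retract / locally contractible, `CechTautness.nonempty_of_locallyContractibleSpace`
after a Whitney embedding of `N`, or retraction neighbourhoods from a tubular-free argument along
`b`) of dimensions `1, h₁(S), 1, 0` for `k = 4, 3, 2, 1` (`S` closed connected oriented:
`nonempty_singularHomology_top_iso`, UCT over `F`, `torsion_singularHomology_eq_bot_of_isOrientableOver_holds`),
`h₄(N; F) = 1`, `h₄(X; F) = 0` (`NoncompactManifold.lean`), Betti symmetry `h₃(N; F) = h₁(N; F)`
(Poincaré duality over `F` + UCT): the alternating sum of
`0 → H₄N → H₄(N,X) → H₃X → H₃N → H₃(N,X) → H₂X → H₂N → H₂(N,X) → H₁X → H₁N → 0` vanishes, and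
its tail `F → H₁X → H₁N → 0` gives the two inequalities; over `ℤ` the segment
`ℤ → H₁(X; ℤ) → H₁(N; ℤ)` with `H₁(N; ℤ)` finitely generated (`finite_singularHomology_of_compactSpace_holds`)
gives finite generation. [folklore] -/
theorem stub_pinch_pieceLES :
    ∀ (N : Type) [TopologicalSpace N] [T2Space N] [SecondCountableTopology N] [CompactSpace N]
      [ConnectedSpace N] [ChartedSpace (𝔼 4) N] [IsManifold (𝓡 4) ∞ N]
      (S : Type) [TopologicalSpace S] [CompactSpace S] [ConnectedSpace S] [ChartedSpace (𝔼 2) S]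
      [IsManifold (𝓡 2) ∞ S] (b : S → N),
      Nonempty (HomologicalOrientation ℤ N 4) → Nonempty (HomologicalOrientation ℤ S 2) →
      Manifold.IsSmoothEmbedding (𝓡 2) (𝓡 4) ∞ b →
      Module.Finite ℤ (singularHomology ℤ ℤ ↥(Set.range b)ᶜ 1) ∧
      ∀ (F : Type) [Field F],
        (∀ k, Module.Finite F (singularHomology F F ↥(Set.range b)ᶜ k)) ∧
        Module.finrank F (singularHomology F F N 1) ≤
          Module.finrank F (singularHomology F F ↥(Set.range b)ᶜ 1) ∧
        Module.finrank F (singularHomology F F ↥(Set.range b)ᶜ 1) ≤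
          Module.finrank F (singularHomology F F N 1) + 1 ∧
        Module.finrank F (singularHomology F F ↥(Set.range b)ᶜ 2) +
            2 * Module.finrank F (singularHomology F F N 1) + 1 =
          Module.finrank F (singularHomology F F S 1) + Module.finrank F (singularHomology F F N 2) +
            Module.finrank F (singularHomology F F ↥(Set.range b)ᶜ 1) +
            Module.finrank F (singularHomology F F ↥(Set.range b)ᶜ 3) := by
  sorry

/-- **Stub P5 — the neighbourhood pair of the surface (N-side, L–XL).**  Let `N` be a closed
connected `ℤ`-oriented 4-manifold, `S` a compact connected `ℤ`-oriented surface, `b : S → N` a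
smooth embedding with image `B`, and `D ⊇ B` open.  (i) For every field `F` the map
`H₁(D ∖ B; F) → H₁(D; F)` induced by the inclusion is onto and its kernel has dimension `≤ 1`.
(ii) If the kernel over `ℚ` is non-zero, then every class `b_* c`, `c ∈ H₂(S; ℤ)`, is carried by
`D ∖ B`: `b_* c = ι_* d` for some `d ∈ H₂(D ∖ B; ℤ)` (`ι : D ∖ B ↪ N`).
Proof plan: exact sequence of the pair `(D, D ∖ B)`; excision into `N`
(`isIso_map_of_closure_subset_interior_holds`) and Čech duality along the compact `B`
(`CechDuality.classAlong_of_isCompact` in `D` or `N`) give `H₁(D, D ∖ B; F) ≅ Ȟ³(B; F) = 0`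
(onto) and `H₂(D, D ∖ B; F) ≅ Ȟ²(B; F) ≅ H²(S; F) ≅ F` (kernel = image of a line); for (ii) a
non-zero rational kernel makes `δ : ℚ → H₁(D ∖ B; ℚ)` injective, so `H₂(D; ℚ) → H₂(D, D∖B; ℚ)`
vanishes, hence so does the integral map into `H₂(D, D ∖ B; ℤ) ≅ ℤ` (torsion-free target,
naturality of `ℤ → ℚ`), so `H₂(D ∖ B; ℤ) → H₂(D; ℤ)` is onto and `b` factors through `D`.
[folklore] -/
theorem stub_pinch_surfaceNbhdPair :
    ∀ (N : Type) [TopologicalSpace N] [T2Space N] [SecondCountableTopology N] [CompactSpace N]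
      [ConnectedSpace N] [ChartedSpace (𝔼 4) N] [IsManifold (𝓡 4) ∞ N]
      (S : Type) [TopologicalSpace S] [CompactSpace S] [ConnectedSpace S] [ChartedSpace (𝔼 2) S]
      [IsManifold (𝓡 2) ∞ S] (b : S → N) (hb : Manifold.IsSmoothEmbedding (𝓡 2) (𝓡 4) ∞ b)
      (D : Set N), IsOpen D → Set.range b ⊆ D →
      Nonempty (HomologicalOrientation ℤ N 4) → Nonempty (HomologicalOrientation ℤ S 2) →
      (∀ (F : Type) [Field F],
        Function.Surjective (singularHomology.map F F
          (⟨Set.inclusion Set.sdiff_subset, continuous_inclusion Set.sdiff_subset⟩ :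
            C(↥(D \ Set.range b), ↥D)) 1) ∧
        Module.finrank F (LinearMap.ker (singularHomology.map F F
          (⟨Set.inclusion Set.sdiff_subset, continuous_inclusion Set.sdiff_subset⟩ :
            C(↥(D \ Set.range b), ↥D)) 1).hom) ≤ 1) ∧
      (LinearMap.ker (singularHomology.map ℚ ℚ
          (⟨Set.inclusion Set.sdiff_subset, continuous_inclusion Set.sdiff_subset⟩ :
            C(↥(D \ Set.range b), ↥D)) 1).hom ≠ ⊥ →
        ∀ c : singularHomology ℤ ℤ S 2,
          ∃ d : singularHomology ℤ ℤ ↥(D \ Set.range b) 2,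
            singularHomology.map ℤ ℤ (⟨Subtype.val, continuous_subtype_val⟩ :
                C(↥(D \ Set.range b), N)) 2 d =
              singularHomology.map ℤ ℤ ⟨b, hb.isEmbedding.continuous⟩ 2 c) := by
  sorry

/-! ## The parity fact is the Literature named fact
`Literature.Geometry.Symplectic.even_one_add_bOne_add_bPlus_of_symplectic_four`
(`EulerCharacteristicAddSignatureOfSymplecticFour.lean`, p117306; McDuff–Salamon 2017 §13.3 p. 527). -/

/-- **Stub F — the named-fact premises of the line (Literature debt, NOT a worker's target).**
The composition consumes two PUBLISHED theorems held by the tree as unproved Literature facts: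
the Chern-number / adjunction package `Literature.Geometry.Symplectic.canonicalClass_sq_and_adjunction_of_symplectic_four`
(relocated by the gate from the landed `stub_genusFormula` file, p83557; its reduction to the
Hirzebruch signature formula + top Chern number + adjunction is in progress in
`CanonicalClassSqAndAdjunctionReduction.lean`) and the parity fact
`Literature.Geometry.Symplectic.even_one_add_bOne_add_bPlus_of_symplectic_four` (p117306).  The third
premise of r2, the Thom–Gysin sequence, is now a THEOREM of the tree
(`Literature.Geometry.Symplectic.thomGysin_complement_surface_four_holds`) and is discharged in
`OrigamiRung_of`.  `ledger skeleton check` admits as hypotheses of `OrigamiRung_of` only route items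
or declared stubs, so — exactly as the first lead had `McDuffWendlAffinePair` registered as route
item stmt-14052 — the two facts are declared here as ONE stub until a planner registers them as
support items of route SymplecticOrigami (requested in the lead's cycle report). [folklore] -/
theorem stub_facts :
    Literature.Geometry.Symplectic.canonicalClass_sq_and_adjunction_of_symplectic_four ∧
    Literature.Geometry.Symplectic.even_one_add_bOne_add_bPlus_of_symplectic_four := by
  sorry

/-! ## The pinch, granted parity (registered; PROVED by the lead in
`Theorems/SymplecticOrigamiOrigamiRungPinchOfParity.lean` from P0–P5 + `PinchBookkeeping.lean`;
kept `sorry` here only until those modules are built on the farm and can be imported) -/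

/-- **Stub 1' — the SW-free integral pinch, granted the parity fact (L; this seat).**  For fold
data on a homotopy 4-sphere there are `g : ℕ` and ranks `k 0 + k 1 = 2g` such that for both
pieces `b₁(S i) = 2g`, `b₂(N i) = 1`, and `H₁(N i ∖ B i; ℤ) ≅ ℤ^{k i}` is FREE — granted
`χ + σ ≡ 0 (mod 4)` for closed symplectic 4-manifolds.  Derived (work/StubPinchOfFacts.lean, rc 0)
from `stub_pinch_sepFun`, `stub_pinch_alexander`, `stub_pinch_exceptionalNbhdIso`,
`stub_pinch_pieceLES`, `stub_pinch_surfaceNbhdPair` by rank bookkeeping over `ℚ` and `𝔽ₚ`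
(see the file docstring); `∀`-form over fully qualified names = the registered signature.
[folklore] -/
theorem stub_pinch_of_parity :
      Literature.Geometry.Symplectic.even_one_add_bOne_add_bPlus_of_symplectic_four → ∀ (M : Type)
      [TopologicalSpace M] [T2Space M] [SecondCountableTopology M] [ChartedSpace (EuclideanSpace ℝ
      (Fin 4)) M] [IsManifold (𝓡 4) ∞ M], M ≃ₕ (Metric.sphere (0 : EuclideanSpace ℝ (Fin 5)) 1) →
      ∀ (V : Fin 2 → TopologicalSpace.Opens M) (N : Fin 2 → Type) [∀ i, TopologicalSpace (N i)] [∀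
      i, T2Space (N i)] [∀ i, SecondCountableTopology (N i)] [∀ i, CompactSpace (N i)] [∀ i,
      ConnectedSpace (N i)] [∀ i, ChartedSpace (EuclideanSpace ℝ (Fin 4)) (N i)] [∀ i, IsManifold
      (𝓡 4) ∞ (N i)] (s : ∀ i, Literature.Geometry.Kaehler.MForm (𝓡 4) (N i) ℝ 2) (S : Fin 2 →
      Type) [∀ i, TopologicalSpace (S i)] [∀ i, CompactSpace (S i)] [∀ i, ConnectedSpace (S i)] [∀
      i, ChartedSpace (EuclideanSpace ℝ (Fin 2)) (S i)] [∀ i, IsManifold (𝓡 2) ∞ (S i)] (b : ∀ i,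
      S i → N i) (β : ∀ i, M → N i), Disjoint (V 0) (V 1) ∧ (∀ i, (V i : Set M).Nonempty) ∧
      IsConnected ((V 0 : Set M) ∪ (V 1 : Set M))ᶜ ∧ (∃ (Z : Type) (_ : TopologicalSpace Z) (_ :
      ChartedSpace (EuclideanSpace ℝ (Fin 3)) Z) (_ : IsManifold (𝓡 3) ∞ Z) (z : Z → M),
      Manifold.IsSmoothEmbedding (𝓡 3) (𝓡 4) ∞ z ∧ Set.range z = ((V 0 : Set M) ∪ (V 1 : Set M))ᶜ)
      → (∀ i, Literature.Geometry.Kaehler.IsSmoothForm (s i) ∧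
      Literature.Geometry.Kaehler.IsClosedForm (s i) ∧ (∀ x (v : TangentSpace (𝓡 4) x), v ≠ 0 → ∃
      w, s i x ![v, w] ≠ 0) ∧ Manifold.IsSmoothEmbedding (𝓡 2) (𝓡 4) ∞ (b i) ∧ (∀ y (v :
      TangentSpace (𝓡 2) y), v ≠ 0 → ∃ w : TangentSpace (𝓡 2) y, s i (b i y) ![mfderiv (𝓡 2) (𝓡 4)
      (b i) y v, mfderiv (𝓡 2) (𝓡 4) (b i) y w] ≠ 0) ∧ (∃ U : Set M, IsOpen U ∧ closure (V i : Set
      M) ⊆ U ∧ ContMDiffOn (𝓡 4) (𝓡 4) ∞ (β i) U) ∧ Set.InjOn (β i) (V i : Set M) ∧ β i '' (V i :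
      Set M) = (Set.range (b i))ᶜ ∧ (∀ x ∈ (V i : Set M), Function.Bijective (mfderiv (𝓡 4) (𝓡 4)
      (β i) x)) ∧ β i '' frontier (V i : Set M) ⊆ Set.range (b i) ∧ (∀ x ∈ frontier (V i : Set M),
      Module.finrank ℝ (LinearMap.ker (mfderiv (𝓡 4) (𝓡 4) (β i) x).toLinearMap) = 1)) → (∀ i,
      frontier (V i : Set M) = ((V 0 : Set M) ∪ (V 1 : Set M))ᶜ ∧ interior (closure (V i : Set M))
      = (V i : Set M)) → ∃ (g : ℕ) (k : Fin 2 → ℕ), k 0 + k 1 = 2 * g ∧ ∀ i, Module.finrank ℤ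
      (Literature.Topology.FourManifolds.singularHomologyZ (S i) 1) = 2 * g ∧ Module.finrank ℤ
      (Literature.Topology.FourManifolds.singularHomologyZ (N i) 2) = 1 ∧ Nonempty
      (Literature.Topology.FourManifolds.singularHomologyZ (↥((Set.range (b i))ᶜ)) 1 ≃+ (Fin (k i)
      → ℤ)) := by
  sorry

/-! ## Derived lemmas over the landed stubs -/

/-- **The ball piece** (the r1 Stub 4, DERIVED from the landed 4a + 4b): fold data
(non-symplectic clauses) + sides + an affine pair structure on `(N i, B i)` ⇒ `closure (V i)` is
the image of a smooth embedding of the closed 4-ball whose boundary sphere goes onto `Z`.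
[folklore] -/
theorem ballPiece :
    ∀ (M : Type) [TopologicalSpace M] [T2Space M] [SecondCountableTopology M] [CompactSpace M]
      [ConnectedSpace M] [ChartedSpace (𝔼 4) M] [IsManifold (𝓡 4) ∞ M]
      (V : Fin 2 → Opens M) (N : Fin 2 → Type) [∀ i, TopologicalSpace (N i)]
      [∀ i, T2Space (N i)] [∀ i, SecondCountableTopology (N i)] [∀ i, CompactSpace (N i)]
      [∀ i, ConnectedSpace (N i)] [∀ i, ChartedSpace (𝔼 4) (N i)] [∀ i, IsManifold (𝓡 4) ∞ (N i)]
      (S : Fin 2 → Type) [∀ i, TopologicalSpace (S i)] [∀ i, CompactSpace (S i)]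
      [∀ i, ConnectedSpace (S i)] [∀ i, ChartedSpace (𝔼 2) (S i)] [∀ i, IsManifold (𝓡 2) ∞ (S i)]
      (b : ∀ i, S i → N i) (β : ∀ i, M → N i),
      (Disjoint (V 0) (V 1) ∧ (∀ i, (V i : Set M).Nonempty) ∧
        IsConnected ((V 0 : Set M) ∪ (V 1 : Set M))ᶜ ∧
        (∃ (Z : Type) (_ : TopologicalSpace Z) (_ : ChartedSpace (𝔼 3) Z)
          (_ : IsManifold (𝓡 3) ∞ Z) (z : Z → M), Manifold.IsSmoothEmbedding (𝓡 3) (𝓡 4) ∞ z ∧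
            Set.range z = ((V 0 : Set M) ∪ (V 1 : Set M))ᶜ)) →
      (∀ i, Manifold.IsSmoothEmbedding (𝓡 2) (𝓡 4) ∞ (b i) ∧
        (∃ U : Set M, IsOpen U ∧ closure (V i : Set M) ⊆ U ∧ ContMDiffOn (𝓡 4) (𝓡 4) ∞ (β i) U) ∧
        Set.InjOn (β i) (V i : Set M) ∧ β i '' (V i : Set M) = (Set.range (b i))ᶜ ∧
        (∀ x ∈ (V i : Set M), Function.Bijective (mfderiv (𝓡 4) (𝓡 4) (β i) x)) ∧
        β i '' frontier (V i : Set M) ⊆ Set.range (b i) ∧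
        (∀ x ∈ frontier (V i : Set M),
          Module.finrank ℝ (LinearMap.ker (mfderiv (𝓡 4) (𝓡 4) (β i) x).toLinearMap) = 1)) →
      (∀ i, frontier (V i : Set M) = ((V 0 : Set M) ∪ (V 1 : Set M))ᶜ ∧
        interior (closure (V i : Set M)) = (V i : Set M)) →
      ∀ i, (∃ (Ψ Θ : N i → 𝔼 4) (W : Set (N i)),
          ContMDiffOn (𝓡 4) 𝓘(ℝ, 𝔼 4) ∞ Ψ (Set.range (b i))ᶜ ∧ Set.InjOn Ψ (Set.range (b i))ᶜ ∧
          Ψ '' (Set.range (b i))ᶜ = Set.univ ∧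
          (∀ x ∈ (Set.range (b i))ᶜ, Function.Bijective (mfderiv (𝓡 4) 𝓘(ℝ, 𝔼 4) Ψ x)) ∧
          IsOpen W ∧ Set.range (b i) ⊆ W ∧ ContMDiffOn (𝓡 4) 𝓘(ℝ, 𝔼 4) ∞ Θ W ∧
          (∀ x ∈ W \ Set.range (b i), Θ x = sphereInversion (Ψ x)) ∧
          (∀ x ∈ Set.range (b i), Θ x = 0 ∧
            Module.finrank ℝ (LinearMap.ker (mfderiv (𝓡 4) 𝓘(ℝ, 𝔼 4) Θ x).toLinearMap) = 2)) →
        ∃ j : 𝔻⁴ → M, Manifold.IsSmoothEmbedding (𝓡∂ (3 + 1)) (𝓡 (3 + 1)) ∞ j ∧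
          Set.range j = closure (V i : Set M) ∧
          Set.range (j ∘ Set.inclusion (Metric.sphere_subset_closedBall :
              Metric.sphere (0 : EuclideanSpace ℝ (Fin (3 + 1))) 1 ⊆ Metric.closedBall 0 1)) =
            ((V 0 : Set M) ∪ (V 1 : Set M))ᶜ := by
  intro M _ _ _ _ _ _ _ V N _ _ _ _ _ _ _ S _ _ _ _ _ b β hdata hβ hsides i hA
  obtain ⟨Ω, f, p, hΩ, hf, hcl, hle, heq, hpV, hfp, huniq, hcrit, hpos⟩ :=
    stub_ballFunction M V N S b β hdata hβ hsides i hA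
  have hcpt : IsCompact {x | x ∈ Ω ∧ f x ≤ 0} := by
    rw [hle]; exact isClosed_closure.isCompact
  obtain ⟨j, hj, hrange, hsph⟩ :=
    stub_ballOfSublevel M Ω f p hΩ hf hcpt (hcl (subset_closure hpV)) hfp huniq hcrit hpos
  exact ⟨j, hj, hrange.trans hle, hsph.trans heq⟩

/-! ## Arithmetic of the genus dichotomy (proved) -/

/-- **The genus dichotomy is arithmetic** once `stub_pinch` and `stub_genusFormula` have spoken:
`k₀ + g² = 3g = k₁ + g²` and `k₀ + k₁ = 2g` force `(g, k₀, k₁) = (0, 0, 0)` or `(2, 2, 2)`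
(`g = 1`: `2 + 2 ≠ 2`; `g = 3`: `0 + 0 ≠ 6`; `g ≥ 4`: `g² > 3g`). -/
theorem genus_arith (g k₀ k₁ : ℕ) (h₀ : k₀ + g * g = 3 * g) (h₁ : k₁ + g * g = 3 * g)
    (hs : k₀ + k₁ = 2 * g) :
    (g = 0 ∧ k₀ = 0 ∧ k₁ = 0) ∨ (g = 2 ∧ k₀ = 2 ∧ k₁ = 2) := by
  have hg : g ≤ 3 := by nlinarith
  interval_cases g <;> omega

/-! ## Composition: the crux BY NAME -/

/-- **`OrigamiRung` from the registered stubs (by name) and the landed ones, under the two route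
items** (`McDuffWendlAffinePair`, stmt-14052; `CerfGammaFour`, stmt-8758 = `cerf_twistedSphere_four`)
**with the Literature facts of `stub_facts`** (`hK`, `hT`; the genus formula was landed conditional
on them).  Kernel-checked; `sorryAx` enters only through `stub_pinch` and `stub_facts` (and, in the
replacement `stub_pinch_of_facts` of the former, through P0–P5).
Route: pinch ⇒ `(g, k)`; genus formula on both pieces ⇒ `genus_arith` ⇒ `g = 2` (doors) or
`g = 0`: spheres (`stub_sphereOfGenusZero`), `H₁(N i ∖ B i) = 0`, `hMW` ⇒ affine pair
structures, `ballPiece` ⇒ two embedded closed balls covering `M` and meeting only along `Z` ⇒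
`IsTwistedSphere 3 φ M` (`SchoenfliesTools.exists_isTwistedSphere`) ⇒ `M ≅ S⁴` (`hC`). -/
theorem OrigamiRung_of
    (hMW : Summit.SmoothPoincare4.SmoothPoincare4.Theses.SymplecticOrigami.McDuffWendlAffinePair)
    (hC : Summit.SmoothPoincare4.SmoothPoincare4.Theses.SymplecticOrigami.CerfGammaFour) :
    Summit.SmoothPoincare4.SmoothPoincare4.Theses.SymplecticOrigami.OrigamiRung := by
  obtain ⟨hK, hPar⟩ := stub_facts
  have hT := Literature.Geometry.Symplectic.thomGysin_complement_surface_four_holds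
  intro M _ _ _ _ _ e V N _ _ _ _ _ _ _ s S _ _ _ _ _ b β hdata hprops
  haveI : CompactSpace M :=
    Literature.Topology.FourManifolds.compactSpace_of_homotopyEquiv_sphere_four_holds M e
  haveI : PathConnectedSpace M := by
    haveI := Literature.Topology.FourManifolds.pathConnectedSpace_sphere_four
    exact Literature.Topology.FourManifolds.pathConnectedSpace_of_homotopyEquiv e
  -- sides of the fold (landed Stub 0): `frontier (V i) = Z` and `V i` regular-open, for both `i`
  have hsides : ∀ i, frontier (V i : Set M) = ((V 0 : Set M) ∪ (V 1 : Set M))ᶜ ∧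
      interior (closure (V i : Set M)) = (V i : Set M) := by
    obtain ⟨Z, _, _, _, z, hz, hrange⟩ := hdata.2.2.2
    intro i
    obtain ⟨h1, h2⟩ := stub_sides M V Z z hdata.1 hdata.2.1 hdata.2.2.1 hz hrange i
    exact ⟨h1.trans hrange, h2⟩
  obtain ⟨g, k, hsum, hpieces⟩ := stub_pinch_of_parity hPar M e V N s S b β hdata hprops hsides
  have hgen : ∀ i, k i + g * g = 3 * g ∧ Module.finrank ℤ (singularHomologyZ (N i) 1) = k i :=
    fun i => stub_genusFormula_of_canonicalClass_of_thomGysin hK hT (N i) (s i) (S i) (b i)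
      (hprops i).1 (hprops i).2.1 (hprops i).2.2.1 (hprops i).2.2.2.1 (hprops i).2.2.2.2.1
      (hpieces i).2.1 g (k i) (hpieces i).1 (hpieces i).2.2
  rcases genus_arith g (k 0) (k 1) (hgen 0).1 (hgen 1).1 hsum with ⟨hg, hk0, hk1⟩ | ⟨hg, hk0, hk1⟩
  · -- genus 0: the endgame
    left
    have hk : ∀ i, k i = 0 := fun i => by fin_cases i <;> assumption
    -- each closed piece is an embedded closed 4-ball with boundary sphere onto `Z`
    have hball : ∀ i, ∃ j : 𝔻⁴ → M, Manifold.IsSmoothEmbedding (𝓡∂ (3 + 1)) (𝓡 (3 + 1)) ∞ j ∧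
        Set.range j = closure (V i : Set M) ∧
        Set.range (j ∘ Set.inclusion (Metric.sphere_subset_closedBall :
            Metric.sphere (0 : EuclideanSpace ℝ (Fin (3 + 1))) 1 ⊆ Metric.closedBall 0 1)) =
          ((V 0 : Set M) ∪ (V 1 : Set M))ᶜ := by
      intro i
      have hsph : Nonempty (S i ≃ₘ⟮𝓡 2, 𝓡 2⟯ 𝕊²) :=
        stub_sphereOfGenusZero (N i) (s i) (S i) (b i) (hprops i).1 (hprops i).2.2.2.1
          (hprops i).2.2.2.2.1 (by rw [(hpieces i).1, hg])
      have hsub : Subsingleton (singularHomologyZ (↥((Set.range (b i))ᶜ)) 1) := by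
        obtain ⟨ε⟩ := (hpieces i).2.2
        haveI : Subsingleton (Fin (k i) → ℤ) := by rw [hk i]; infer_instance
        exact ε.toEquiv.subsingleton
      have hA := hMW (N i) (s i) (S i) (b i) (hprops i).1 (hprops i).2.1 (hprops i).2.2.1
        (hprops i).2.2.2.1 (hprops i).2.2.2.2.1 hsph (hpieces i).2.1 hsub
      exact ballPiece M V N S b β hdata (fun i => ⟨(hprops i).2.2.2.1, (hprops i).2.2.2.2.2⟩)
        hsides i hA
    choose j hj using hball
    -- the two balls cover `M` and meet exactly along `Z` = both boundary spheres: a twisted sphere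
    have hZ : ∀ i, ((V 0 : Set M) ∪ (V 1 : Set M))ᶜ ⊆ Set.range (j i) := fun i => by
      rw [← (hj i).2.2]
      exact Set.range_comp_subset_range _ _
    have hcover : Set.range (j 0) ∪ Set.range (j 1) = Set.univ := by
      apply Set.eq_univ_of_forall
      intro x
      by_cases hx : x ∈ (V 0 : Set M) ∪ (V 1 : Set M)
      · rcases hx with hx | hx
        · left; rw [(hj 0).2.1]; exact subset_closure hx
        · right; rw [(hj 1).2.1]; exact subset_closure hx
      · exact Or.inl (hZ 0 hx)
    have hdisj : Disjoint (V 0 : Set M) (V 1 : Set M) := Opens.coe_disjoint.2 hdata.1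
    have hmeet : ∀ x, x ∈ closure (V 0 : Set M) → x ∈ closure (V 1 : Set M) →
        x ∈ ((V 0 : Set M) ∪ (V 1 : Set M))ᶜ := by
      intro x h0 h1 hx
      rcases hx with hx | hx
      · obtain ⟨y, hy0, hy1⟩ := mem_closure_iff.1 h1 (V 0 : Set M) (V 0).isOpen hx
        exact Set.disjoint_left.1 hdisj hy0 hy1
      · obtain ⟨y, hy1, hy0⟩ := mem_closure_iff.1 h0 (V 1 : Set M) (V 1).isOpen hx
        exact Set.disjoint_left.1 hdisj hy0 hy1
    have hAB : ∀ a c, j 0 a = j 1 c →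
        ‖(a : EuclideanSpace ℝ (Fin (3 + 1)))‖ = 1 ∧ ‖(c : EuclideanSpace ℝ (Fin (3 + 1)))‖ = 1 := by
      intro a c hac
      have h0 : j 0 a ∈ closure (V 0 : Set M) := by rw [← (hj 0).2.1]; exact ⟨a, rfl⟩
      have h1 : j 0 a ∈ closure (V 1 : Set M) := by rw [← (hj 1).2.1, hac]; exact ⟨c, rfl⟩
      have hxZ := hmeet _ h0 h1
      constructor
      · have hx : j 0 a ∈ Set.range (j 0 ∘ Set.inclusion (Metric.sphere_subset_closedBall :
            Metric.sphere (0 : EuclideanSpace ℝ (Fin (3 + 1))) 1 ⊆ Metric.closedBall 0 1)) := by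
          rw [(hj 0).2.2]; exact hxZ
        obtain ⟨a', ha'⟩ := hx
        have : Set.inclusion Metric.sphere_subset_closedBall a' = a :=
          (hj 0).1.isEmbedding.injective ha'
        rw [← this]
        exact mem_sphere_zero_iff_norm.1 a'.2
      · have hx : j 1 c ∈ Set.range (j 1 ∘ Set.inclusion (Metric.sphere_subset_closedBall :
            Metric.sphere (0 : EuclideanSpace ℝ (Fin (3 + 1))) 1 ⊆ Metric.closedBall 0 1)) := by
          rw [(hj 1).2.2, ← hac]; exact hxZ
        obtain ⟨c', hc'⟩ := hx
        have : Set.inclusion Metric.sphere_subset_closedBall c' = c :=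
          (hj 1).1.isEmbedding.injective hc'
        rw [← this]
        exact mem_sphere_zero_iff_norm.1 c'.2
    have hcirc : Set.range (j 0 ∘ Set.inclusion (Metric.sphere_subset_closedBall :
            Metric.sphere (0 : EuclideanSpace ℝ (Fin (3 + 1))) 1 ⊆ Metric.closedBall 0 1)) =
        Set.range (j 1 ∘ Set.inclusion (Metric.sphere_subset_closedBall :
            Metric.sphere (0 : EuclideanSpace ℝ (Fin (3 + 1))) 1 ⊆ Metric.closedBall 0 1)) := by
      rw [(hj 0).2.2, (hj 1).2.2]
    obtain ⟨φ, hT⟩ :=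
      Literature.Topology.FourManifolds.SchoenfliesTools.exists_isTwistedSphere
        (hj 0).1 (hj 1).1 hcover hAB hcirc
    exact Literature.Topology.FourManifolds.nonempty_diffeomorph_sphere_four_of_isTwistedSphere_of_cerf
      (cerfGammaFour_iff.1 hC) hT
  · -- genus 2: both pieces are doors
    right
    intro i
    refine ⟨?_, (hpieces i).2.1⟩
    rw [(hgen i).2]
    fin_cases i <;> assumption

/-- The skeleton over the tree's Cerf fact directly. -/
example (hMW : Summit.SmoothPoincare4.SmoothPoincare4.Theses.SymplecticOrigami.McDuffWendlAffinePair)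
    (hC : cerf_twistedSphere_four) :
    Summit.SmoothPoincare4.SmoothPoincare4.Theses.SymplecticOrigami.OrigamiRung :=
  OrigamiRung_of hMW (cerfGammaFour_iff.2 hC)

end Summit.SmoothPoincare4.SmoothPoincare4.Cruxes.OrigamiRung.PairRigidityEndgame

end
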